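import Literature.NumberTheory.Automorphic.IsAutomorphicAE
import Literature.NumberTheory.Automorphic.AdicCompletionLocalField
import Literature.NumberTheory.GaloisRepresentations.LabelledHodgeTateWeights
import Literature.NumberTheory.GaloisRepresentations.ResidualGaloisRep
import Literature.NumberTheory.GaloisRepresentations.OrdinaryTwistedDeterminant
import Literature.NumberTheory.PAdicHodge.FontaineDpst
import HarnessLib

/-!
# Fontaine–Mazur for `GL₂/ℚ` at an odd prime in WEIGHT ONE (Hodge–Tate weights `0,0`):
# Pan 2022, Forum Math. Pi 10, Thm. 1.0.5 (= Thm. 6.4.8 + Cor. 6.4.9; Pilloni–Stroh 2016)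

Topic `Literature/NumberTheory/Automorphic`; the IRREGULAR-weight companion of
`FontaineMazurGL2OddPrime` / `FontaineMazurGL2OddPrimeTateTwist` (Pan JAMS 2022 Thm. 1.0.4, X. Zhang
2024: the REGULAR case, distinct Hodge–Tate weights, no residual hypothesis).  This file vendors, as a
NAMED FACT (D-0014, conventions §4), the printed weight-one theorem — the case of EQUAL Hodge–Tate
weights `0,0`, where the expected automorphic form is a classical weight-one eigenform (finite image,
Deligne–Serre) and the Taylor–Wiles–Kisin method does not apply (positive defect `l₀ = 1`; weight-one
forms are not in the étale cohomology of Shimura varieties) — with the residual hypotheses under which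
it is in print.

## The printed theorem (held text arXiv:2008.07099, p. 5, quoted)

L. Pan, *On locally analytic vectors of the completed cohomology of modular curves*, Forum Math. Pi 10
(2022) e5 [Pan2022LocallyAnalytic].  **Theorem 1.0.5** "(Theorem 6.4.8 and Corollary 6.4.9)":
"Let `p > 2` be a prime number and `ρ : Gal(ℚ̄/ℚ) → GL₂(ℚ̄_p)` a continuous irreducible
two-dimensional representation.  Assume
 • `ρ` is unramified outside of finitely many primes;
 • `det ρ(c) = -1` for a complex conjugation `c ∈ Gal(ℚ̄/ℚ)`;
 • `ρ|_{G_{ℚ_p}}` is Hodge–Tate of weights `0,0`;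
 • the residual representation `ρ̄|_{Gal(ℚ̄/ℚ(μ_p))}` is irreducible;
 • `(ρ̄|_{G_{ℚ_p}})^{ss}` is either irreducible or of the form `η₁ ⊕ η₂` for some characters `η₁, η₂`
   satisfying `η₁/η₂ ≠ 1, ω^{±1}`.
Then `ρ` is modular in the sense that it is isomorphic to the representation attached to a classical
weight one cuspidal eigenform by [DS74].  In particular, `ρ` has finite image."
**Remark 1.0.6**: "This result was already known by the work of Pilloni–Stroh [PS16].  Before their work,
much work on this problem was done in the ordinary case: Buzzard–Taylor [BT99], Calegari–Geraghty
[CG18] … If the results of this paper can also be generalized to Hilbert case, one should be able to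
remove the last two conditions by invoking our previous work on promodularity [Pan19]."
**Remark 6.4.10** (p. 53): "The last two conditions in Corollary 6.4.9 come from the conditions in
Theorem 6.4.8 [Emerton's pro-modularity, [Eme11] Thm. 1.2.3].  The first condition basically
guarantees the existence of Taylor–Wiles primes and the second condition guarantees certain mod `p`
multiplicity one result.  It is possible to remove both conditions by working with Shimura curves
and Hilbert modular varieties.  [By [Pan19] `ρ|G_F` is irreducible and pro-modular for a solvable
totally real `F` with `p` completely split, for ANY irreducible odd a.e.-unramified `ρ` (`p > 2`;
`p = 3` needs `(ρ̄|G_{ℚ_p})^{ss} ≇ η ⊕ ηω`).]  It seems very reasonable to expect the main result of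
this paper (Theorem 1.0.1) extends to the context of Shimura curves and Hilbert modular varieties
when `p` is completely split in `F`. If so, `ρ|G_F` is modular … by solvable base change `ρ` is
also modular."  (The bracketed sentence paraphrases the remark's first item.)

## The rendering (typed vocabulary of `FontaineMazurGL2OddPrime` and of the summit `Langlands`)

* `ρ : FramedGaloisRep ℚ (PadicAlgCl p) 2` — a CONTINUOUS homomorphism `Γ_ℚ →ₜ* GL₂(ℚ̄_p)`;
  "unramified outside finitely many primes" — `∀ᶠ v in cofinite, ρ.IsUnramifiedAt v`; "irreducible" —
  `ρ.toGaloisRep.IsIrreducible`; "`det ρ(c) = -1`" — `ρ.IsOdd` (for every complex conjugation; all are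
  conjugate and `det` is a class function).
* "`ρ̄|Γ_{ℚ(μ_p)}` irreducible" (over `𝔽̄_p`, i.e. absolutely) — the accepted
  `(ρ.restrictField (CyclotomicField p ℚ)).IsResiduallyAbsIrreducible` ("some reduction over `ℤ̄_p/𝔪` is
  absolutely irreducible"), verbatim the clause of `Tung2021_fontaineMazurGL2`.
* The local residual genericity — `IsResiduallyGenericGL2At ρ v` (this file): there are
  NO continuous finite-order characters `η₁, η₂ : Γ_{ℚ_v} → ℚ̄_pˣ` with `tr ρ|Γ_{ℚ_v} ≡ η₁ + η₂ (mod 𝔪)`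
  and `η₁ ≡ η₂`, `η₁ ≡ ε η₂` or `η₂ ≡ ε η₁ (mod 𝔪)` (`ε = cyclotomicPadicAlgCl ℚ_v p`, `ε ≡ ω`).  For
  `p > 2` this is EQUIVALENT to the printed clause: by Brauer–Nesbitt a two-dimensional semisimple
  `𝔽̄_p`-representation is determined by its trace (`det = (tr² - tr ∘ sq)/2`), so
  `(ρ̄|G_{ℚ_p})^{ss} ≅ η̄₁ ⊕ η̄₂` iff `tr ρ̄|G_{ℚ_p} = η̄₁ + η̄₂`, every residual character lifts to its
  (finite-order, continuous) Teichmüller lift, and `η̄₁/η̄₂ = ω^{±1}` iff `η₁ ≡ ε^{±1} η₂ (mod 𝔪)`.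
  (`ρ.toLocal v` is the restriction along the tree's fixed `Γ_{ℚ_v} → Γ_ℚ`; the clause is conjugation
  invariant, so the choice of decomposition group is immaterial.)
* "`ρ|G_{ℚ_p}` is Hodge–Tate of weights `0,0`" — rendered, as a formally STRONGER hypothesis (so the
  rendered fact is implied by the printed one), by: `ρ|Γ_{ℚ_v}` is de Rham for Fontaine's PINNED datum
  `PAdicHodge.fontainePstAdicCompletion v p hv` (= the summit's `ReciprocityData.pst`, by `rfl`) AND its
  `τ`-labelled Hodge–Tate weights (accepted `FramedGaloisRep.labelledHodgeTateWeightsAt`, the vocabulary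
  of `XZhang2024_fontaineMazurGL2_tateTwist`, there with `.Nodup`) are the multiset `{0, 0}` for every
  continuous label `τ : ℚ_v → ℚ̄_p` (for `v = (p)` there is exactly one).  Nothing of substance is lost:
  Hodge–Tate of weights `0,0` means `ρ ⊗ C_p ≅ C_p²`, which by Sen's theorem forces `ρ(I_p)` finite,
  i.e. `ρ|G_{ℚ_p}` potentially unramified, hence de Rham with weights `0,0`.
* CONCLUSION, automorphically (as `Tung2021_hilbertTotallySplit`, `BLGGT2014_thm421_GL2_totallyReal` and
  the summit's clause (B) `Summit.Langlands.GaloisToAutomorphic`): for every `hcpt` and every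
  `ι : ℚ̄_p ≃+* ℂ` there is a CUSPIDAL automorphic representation `π` of `GL₂(𝔸_ℚ)` which is
  `L`-ALGEBRAIC and attached to `ρ` at almost all places, `SatakeFrobCompatibleAE ι π ρ` (Buzzard–Gee's
  `L`-normalisation: at a.e. `v`, `π_v` unramified with Satake parameter `α`, `ρ` unramified,
  `charpoly ρ(Frob_v) = ∏ (X - ι⁻¹(α_j⁻¹))`).  This is implied by the printed conclusion: if
  `ρ ≅ ρ_{f,λ} ⊗ ℚ̄_p` for a classical weight-one newform `f` (nebentypus `χ`) and `λ : K_f → ℚ̄_p`, put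
  `σ = ι ∘ λ : K_f → ℂ` and `g = f^σ` (a weight-one newform with `a_q(g) = σ(a_q(f))`); the unitary
  cuspidal `π_g` (or its contragredient, according to the arithmetic/geometric Frobenius convention of
  [DS74] Thm. 6.1 versus `arithFrobPolyOfSatake`) has `π_∞` with Harish-Chandra parameter
  `((k-1)/2, (1-k)/2) = (0,0) ∈ X^*(T)`, so it is `L`-algebraic WITHOUT any twist (Buzzard–Gee 2014
  §3.1: for `GL₂` the weight-`k` unitary `π_f` is `L`-algebraic iff `k` is odd), and its Satake
  parameters at `q ∤ Np` are the roots of `X² - a_q(g) X + χ^σ(q)` (no `q^{(k-1)/2}` shift at `k = 1`),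
  matching `charpoly ρ(Frob_q) = λ(X² - a_q(f) X + χ(q))` through `ι`.  The finer printed information
  (weight-one NEWFORM, finite image, local–global compatibility at the ramified primes and at `p`) is
  deliberately NOT rendered — exactly as the regular companions render only the a.e. dictionary.

## Status of the hypotheses (for consumers; why this is the FLOOR of a ladder)

The two residual hypotheses are those of Emerton's pro-modularity theorem ([Eme11] Thm. 1.2.3, via
Böckle, Diamond–Flach–Guo, Khare–Wintenberger, Kisin); Pan's Remarks 1.0.6 / 6.4.10 record that
removing them needs the paper's weight-one classicality (Thm. 1.0.4: pro-modular + Hodge–Tate `(0,0)`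
⇒ classical weight one, proved for MODULAR CURVES) on Shimura curves / Hilbert modular varieties at a
completely split `p` — not in print (the printed Hilbert-case classicality results, Diao–Su 2025
arXiv:2505.10290 and Su arXiv:2512.04641, are for REGULAR `σ`-weights).  Without the Taylor–Wiles
hypothesis the residually reducible weight-one case is open (Berger–Klosin, Trans. AMS 376 (2023) =
arXiv:2203.09434: "the case of `k = 1` is different …", partial `R = T` results), as is the
cyclotomic-dihedral case `ρ̄ ≅ Ind_{ℚ(√p*)}^ℚ χ̄` (handled in REGULAR weight by Pan JAMS 2022 §7 following
Skinner–Wiles 2001).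

## What is NOT here

No discharge (XL: Scholze's `π_HT`, the `𝒪_{K^p}`-module structure of locally analytic completed
cohomology, Emerton's local–global compatibility); `p = 2`; `F ≠ ℚ`; the non-generic local residual
shapes `η ⊕ η`, `η ⊕ ηω^{±1}` (in print only for `ρ` UNRAMIFIED at `p`: Buzzard–Taylor 1999
(`p`-distinguished), Calegari–Geraghty 2018 Cor. 1.4 (minimal) — not vendored here); local–global
compatibility at ramified places.

## References

* L. Pan, *On locally analytic vectors of the completed cohomology of modular curves*, Forum Math. Pi
  10 (2022) e5, Thm. 1.0.4, Thm. 1.0.5, Rem. 1.0.6, Thm. 6.4.8, Cor. 6.4.9, Rem. 6.4.10 (numbering of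
  arXiv:2008.07099). [Pan2022LocallyAnalytic]
* L. Pan, J. Amer. Math. Soc. 35 (2022) 1031–1169 (arXiv:1901.07166), Thm. 1.0.2, Thm. 1.0.4, §7. [Pan2022]
* V. Pilloni, B. Stroh, *Surconvergence, ramification et modularité*, Astérisque 382 (2016) 195–266.
* K. Buzzard, R. Taylor, Ann. of Math. 149 (1999) 905–919. [BuzzardTaylor1999]
* F. Calegari, D. Geraghty, Invent. Math. 211 (2018) 297–433, Thm. 1.3, Cor. 1.4. [CalegariGeraghty2017]
* T. Berger, K. Klosin, *`R = T` theorems for weight one modular forms*, Trans. AMS 376 (2023),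
  arXiv:2203.09434, §1.
* P. Deligne, J.-P. Serre, Ann. Sci. ÉNS 7 (1974), Thm. 6.1. [DeligneSerreASENS1974]
* K. Buzzard, T. Gee, LMS Lecture Note Ser. 414 (2014), §3.1, Conj. 3.2.1. [BuzzardGeeLMS2014]
-/

noncomputable section

open scoped MatrixGroups Matrix NumberField
open NumberField IsDedekindDomain Field Filter

namespace Literature.NumberTheory.Automorphic

open Literature.NumberTheory.GaloisRepresentations

/-- **Residual genericity of `ρ|Γ_{K_v}` at a place `v ∣ p`** (the last hypothesis of Pan 2022
Thm. 1.0.5, over any number field `K`): `(ρ̄|Γ_{K_v})^{ss}` is NOT of the form `η₁ ⊕ η₂` with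
`η₁/η₂ ∈ {1, ω, ω⁻¹}` — trace rendering (Brauer–Nesbitt, `p > 2`): there are no finite-order continuous
characters `η₁, η₂ : Γ_{K_v} → ℚ̄_pˣ` (open kernels) with `tr ρ(σ) ≡ η₁(σ) + η₂(σ) (mod 𝔪)` for all
`σ ∈ Γ_{K_v}` and `η₁ ≡ η₂`, `η₁ ≡ ε·η₂` or `η₂ ≡ ε·η₁ (mod 𝔪)`, `ε = cyclotomicPadicAlgCl K_v p` the
`p`-adic cyclotomic character of `Γ_{K_v}` (`ε ≡ ω mod 𝔪`).  "`≡ (mod 𝔪)`" is `‖·‖ < 1` in `ℚ̄_p`.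
[cite: Pan2022LocallyAnalytic, Thm. 1.0.5 (last hypothesis) and Rem. 6.4.10] -/
def IsResiduallyGenericGL2At {K : Type} [Field K] [NumberField K] {p : ℕ} [Fact p.Prime]
    (ρ : FramedGaloisRep K (PadicAlgCl p) 2) (v : HeightOneSpectrum (𝓞 K)) : Prop :=
  ¬ ∃ η₁ η₂ : absoluteGaloisGroup (v.adicCompletion K) →* (PadicAlgCl p)ˣ,
      IsOpen (η₁.ker : Set (absoluteGaloisGroup (v.adicCompletion K))) ∧
      IsOpen (η₂.ker : Set (absoluteGaloisGroup (v.adicCompletion K))) ∧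
      (∀ σ, ‖(ρ.toLocal v σ).val.trace - ((η₁ σ : PadicAlgCl p) + (η₂ σ : PadicAlgCl p))‖ < 1) ∧
      ((∀ σ, ‖(η₁ σ : PadicAlgCl p) - (η₂ σ : PadicAlgCl p)‖ < 1) ∨
       (∀ σ, ‖(η₁ σ : PadicAlgCl p) -
          (cyclotomicPadicAlgCl (v.adicCompletion K) p σ : PadicAlgCl p) * (η₂ σ : PadicAlgCl p)‖ < 1) ∨
       (∀ σ, ‖(η₂ σ : PadicAlgCl p) -
          (cyclotomicPadicAlgCl (v.adicCompletion K) p σ : PadicAlgCl p) * (η₁ σ : PadicAlgCl p)‖ < 1))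

/-- **`ρ|Γ_{K_v}` is de Rham with labelled Hodge–Tate weights `{0, 0}` at every `v ∣ p`** (the
WEIGHT-ONE sector; Pan's "`ρ|G_{ℚ_p}` is Hodge–Tate of weights `0,0`", rendered as the formally
stronger clause: de Rham for Fontaine's pinned datum `fontainePstAdicCompletion v p hv` with
`τ`-labelled weights `{0,0}` for every continuous label `τ : K_v → ℚ̄_p` — see the module docstring;
Hodge–Tate of weights `0,0` ⇒ potentially unramified (Sen) ⇒ de Rham).
[cite: Pan2022LocallyAnalytic, Thm. 1.0.5 (third hypothesis) and Thm. 1.0.4] -/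
def IsDeRhamWeightZeroGL2 {K : Type} [Field K] [NumberField K] (p : ℕ) [Fact p.Prime]
    (ρ : FramedGaloisRep K (PadicAlgCl p) 2) : Prop :=
  ∀ (v : HeightOneSpectrum (𝓞 K)) (hv : ((p : ℕ) : 𝓞 K) ∈ v.asIdeal),
    (PAdicHodge.fontainePstAdicCompletion v p hv).IsDeRhamFramed (ρ.toLocal v) ∧
    ∀ τ : v.adicCompletion K →+* PadicAlgCl p, Continuous τ →
      ρ.labelledHodgeTateWeightsAt v (PAdicHodge.fontainePstAdicCompletion v p hv).algebra
        (PAdicHodge.fontainePstAdicCompletion v p hv).𝔅 τ = {0, 0}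

/-- **Pan 2022 (Forum Math. Pi 10), Thm. 1.0.5 = Thm. 6.4.8 + Cor. 6.4.9; Pilloni–Stroh 2016:
Fontaine–Mazur for `GL₂` over `ℚ` at an odd prime in WEIGHT ONE, under the Taylor–Wiles and the local
genericity hypotheses** (module docstring for the printed statement and the rendering).  Let `p > 2`
and let `ρ : Γ_ℚ → GL₂(ℚ̄_p)` be continuous, unramified at all but finitely many places, irreducible
and odd, with `ρ̄|Γ_{ℚ(μ_p)}` absolutely irreducible, `ρ|Γ_{ℚ_p}` residually generic
(`IsResiduallyGenericGL2At`: `(ρ̄|G_{ℚ_p})^{ss}` irreducible or `η₁ ⊕ η₂` with `η₁/η₂ ≠ 1, ω^{±1}`) and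
de Rham at `p` for Fontaine's pinned datum with labelled Hodge–Tate weights `{0,0}`
(`IsDeRhamWeightZeroGL2`).  Then `ρ` is the Deligne–Serre representation of a classical weight-one
cuspidal eigenform; rendered: for every `hcpt` and every `ι : ℚ̄_p ≃+* ℂ` there is a cuspidal
automorphic representation `π` of `GL₂(𝔸_ℚ)`, `L`-algebraic, with `SatakeFrobCompatibleAE ι π ρ`.
Named fact (D-0014); users take `(h : Pan2022_fontaineMazurGL2_weightOne)`.
[cite: Pan2022LocallyAnalytic, Thm. 1.0.5 (= Thm. 6.4.8 and Cor. 6.4.9, p. 53 of arXiv:2008.07099), Rem. 1.0.6, Rem. 6.4.10]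
[cite: DeligneSerreASENS1974, Thm. 6.1] [cite: BuzzardGeeLMS2014, §3.1 and Conj. 3.2.1] -/
def Pan2022_fontaineMazurGL2_weightOne : Prop :=
  ∀ (p : ℕ) [Fact p.Prime], p ≠ 2 →
    ∀ (ρ : FramedGaloisRep ℚ (PadicAlgCl p) 2),
      (∀ᶠ v : HeightOneSpectrum (𝓞 ℚ) in cofinite, ρ.IsUnramifiedAt v) →
      ρ.toGaloisRep.IsIrreducible → ρ.IsOdd →
      (ρ.restrictField (CyclotomicField p ℚ)).IsResiduallyAbsIrreducible →
      (∀ v : HeightOneSpectrum (𝓞 ℚ), ((p : ℕ) : 𝓞 ℚ) ∈ v.asIdeal → IsResiduallyGenericGL2At ρ v) →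
      IsDeRhamWeightZeroGL2 p ρ →
      ∀ (hcpt : isCompact_glFiniteIntegralLevel 2 ℚ) (ι : PadicAlgCl p ≃+* ℂ),
        ∃ π : CuspidalAutomorphicRepData 2 ℚ hcpt, π.1.IsLAlgebraic ∧ SatakeFrobCompatibleAE ι π.1 ρ

end Literature.NumberTheory.Automorphic

end
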